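import Mathlib
import HarnessLib
import Summits.HubbardSuperconductivity.HubbardSuperconductivity.Theorems.KLProgrammeKLRegimeEngineV17F2RowBPlainSplit

/-!
# Route `KLProgramme` — ENGINE (stmt-HubbardSuperconductivity-20437 `KLRegimeEngineV17F2`), ROW (b): BINDER #5 (the UV-cut (E4) conjunct of E1's row
# family `hE₁cut`) SPLIT BY TYPE into the LANDED bare-vertex row and a REMAINDER conjunct on `𝒱ᵢ − V`; slot (b) with BOTH quartic binders re-keyed
(cell gate-hubbard-kl; visitor seat leafhand-hubbard-klprogramme-3 g0; helper `--supports stmt-HubbardSuperconductivity-20437` toward the registered stub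
`stub_engine_step_norms` (slot (b) of ★ PIN v22); companion of `…RowBPlainSplit` (binder #6))

E1's row family `hE₁cut` (slot-(b) binder of ★ v22) is `∃ s₂u s₂c s₄ S₆ …, (E2) ∧ (E4) ∧ (E6)` under `hW`'s binders; its (E4) conjunct (binder #5 of the
E1-LEDGER) asks the `klScaleWt_i`-weighted UV-cut PLAIN quartic pinned sums of `𝒱ᵢ[Kₙ] = klEffectiveAction … (klFlowFrameU … n) klE0 i`, every
`1 ≤ i ≤ n`, every pinned leg `q`, every string `τ′`, to be `≤ s₄ · epsCoupling P U i`.  As for binder #6, the bare-vertex part is IN THE TREE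
(✓ p787853 `klbv_scaleWtCurrency_uvCut_hubbardInteraction_le_allStrings`, every pinned leg), and `P.WF` gives `1 ≤ Klam`, so
`(|U|/24)·(8⁴ + 2·klE0·(8·20000·8³)) ≤ a_b · Klam·|U| ≤ a_b · epsCoupling P U i` with `a_b = (8⁴ + 2·klE0·(8·20000·8³))/24`.
* **`hE₁cut_of_remainder`** — `hE₁cut` VERBATIM from the same family with the (E4) conjunct stated for the REMAINDER `𝒱ᵢ[Kₙ] − V` ((E2), (E6) and all
  binders unchanged); `s₄ := s₄′ + a_b`.
* **`stub_engine_step_norms_of_E1data₃LBcut56_remainder₂ hE₁rem ha′ hb hu₀ hrem hincr′`** ⊢ row (b) VERBATIM — the ★ v22 slot-(b) reader with BOTH plain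
  quartic binders (#5 and #6) replaced by their remainders: the bare quartic vertex is discharged from slot (b) by type.
Honest framing: bookkeeping; the remainder rows (loop corrections + counterterm insertions of the quartic kernel at every level `i ≤ n`) are E1-class
HYPOTHESES with no supplier in the tree; nothing here asserts them, row (b), any stub of 20437, K3, U₀, the window or superconductivity.
References: BGM 2006 §2.3 (2.23), §2.8 (2.76)–(2.84), §3 (3.2)–(3.8) [cite: BenfattoGiulianiMastropietro2006].
-/

noncomputable section

namespace Summit.HubbardSuperconductivity.HubbardSuperconductivity.Theorems.EngineV8.A24a1G14

set_option linter.dupNamespace false -- summit = problem name (single-conjunct summit), D-0017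

open Classical
open Real Finset Literature.MathematicalPhysics.QuantumLattice Literature.Probability.LatticeModels GrassmannAlgebra
open Literature.MathematicalPhysics.QuantumLattice.FermiRG
open Summit.HubbardSuperconductivity.HubbardSuperconductivity.Theorems.KLProgrammeLegKernels
open Summit.HubbardSuperconductivity.HubbardSuperconductivity.Theorems.KLRegimeSplit
open Summit.HubbardSuperconductivity.HubbardSuperconductivity.Theorems.DispersionFlow
open Summit.HubbardSuperconductivity.HubbardSuperconductivity.Theorems.EngineV8

/-! ## §1 The bare-vertex row in the (E4) currency `s₄ · epsCoupling P U i` -/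

/-- **The bare vertex's weighted cut plain quartic row in the (E4) currency**: for `1 ≤ Klam`, `128 ≤ β ≤ M`, every level `i`, pinned leg `q`, pin
`y`, string `τ′`, `ε³ Σ_{x′ : x′_q = y} klScaleWt_i(S(x′))·‖W₄(S_ĝ V)(τ′; x′)‖ ≤ ((8⁴ + 2·klE0·(8·20000·8³))/24) · epsCoupling P U i`
(✓ `klbv_scaleWtCurrency_uvCut_hubbardInteraction_le_allStrings`, `klScale_klE0_le_klE0`, `|U| ≤ Klam·|U| ≤ epsCoupling P U i`). [folklore] -/
theorem klbv_scaleWtCurrency_uvCut_hubbardInteraction_le_epsCoupling {L M : ℕ} [NeZero L] [NeZero M] {P : SplitConsts} (hK : 1 ≤ P.Klam)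
    {β : ℝ} (hβ : 128 ≤ β) (hM : β ≤ M) (i : ℕ) (U : ℝ) (τ' : Fin 4 → SectorLeg 1) (q : Fin 4) (y : SpaceTimeIdx L M) :
    imagTimeWeight β M ^ 3 *
        ∑ x ∈ univ.filter (fun x : Fin 4 → SpaceTimeIdx L M => x q = y),
          klScaleWt L M β i ((univ.image x).image (fun z : SpaceTimeIdx L M => (((((2 * (z.1 : ℕ) : ℕ)) : ZMod (2 * (2 * M)))), z.2))) *
          ‖sectorisedKernel L M β (trivialMultiplier L M)
            (ExteriorAlgebra.map (LinearMap.mulLeft ℂ (fun K : HubbardFieldIdx L M => ((gnScaleCutoff 4 klE0 1 |matsubaraFreq β M K.1.1.1| : ℝ) : ℂ))) (hubbardInteraction L M β U)) 4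
            τ' x‖ ≤
      (8 ^ 4 + 2 * klE0 * (8 * 20000 * 8 ^ 3)) / 24 * epsCoupling P U i := by
  have hbare := klbv_scaleWtCurrency_uvCut_hubbardInteraction_le_allStrings (L := L) (M := M) hβ hM i U τ' q y
  have hΛi : klScale klE0 i ≤ klE0 := klScale_klE0_le_klE0 i
  have hE : (0 : ℝ) < klE0 := by norm_num [klE0]
  have hε : P.Klam * |U| ≤ epsCoupling P U i := klam_mul_abs_le_epsCoupling (le_trans zero_le_one hK) U i
  have hUK : |U| ≤ P.Klam * |U| := by
    have := mul_le_mul_of_nonneg_right hK (abs_nonneg U)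
    linarith
  have hUε : |U| ≤ epsCoupling P U i := hUK.trans hε
  refine hbare.trans ?_
  have h1 : |U| / 24 * (8 ^ 4 + 2 * klScale klE0 i * (8 * 20000 * 8 ^ 3)) ≤ |U| / 24 * (8 ^ 4 + 2 * klE0 * (8 * 20000 * 8 ^ 3)) := by
    have hU0 : 0 ≤ |U| / 24 := by positivity
    gcongr
  refine h1.trans ?_
  rw [show |U| / 24 * (8 ^ 4 + 2 * klE0 * (8 * 20000 * 8 ^ 3)) = (8 ^ 4 + 2 * klE0 * (8 * 20000 * 8 ^ 3)) / 24 * |U| by ring]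
  exact mul_le_mul_of_nonneg_left hUε (by positivity)

/-! ## §2 `hE₁cut` from its remainder -/

/-- **BINDER #5 — E1's ROW FAMILY `hE₁cut` FROM ITS REMAINDER, BY TYPE.**  If E1's (E2) ∧ (E4) ∧ (E6) family holds with the (E4) conjunct stated for the
REMAINDER `𝒱ᵢ[Kₙ] − V` (`V = hubbardInteraction L M β U`; constants `s₂u s₂c s₄′ S₆`), then `hE₁cut` holds verbatim with `s₄ := s₄′ + (8⁴ +
2·klE0·(8·20000·8³))/24`: the bare quartic vertex's row is ✓ `klbv_scaleWtCurrency_uvCut_hubbardInteraction_le_epsCoupling` (`1 ≤ Klam` from `P.WF`,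
`128 = klBetaMin ≤ β ≤ klEngM₃ β U L ≤ M`), added through `klbv_wtPinnedSum_norm_sectorisedKernel_le_add` and `map_sub`.
[cite: BenfattoGiulianiMastropietro2006, §2.8 (2.76)-(2.84), §3 (3.2)-(3.8)] -/
theorem hE₁cut_of_remainder
    (hE₁rem : ∀ (P : SplitConsts) (R : RenConsts), P.WF → R.WF2 →
      ∃ s₂u s₂c s₄ S₆ : ℝ, 0 ≤ s₂u ∧ 0 ≤ s₂c ∧ 0 ≤ s₄ ∧ 0 ≤ S₆ ∧ ∃ cE UE : ℝ, 0 < cE ∧ 0 < UE ∧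
      ∀ (Q : EngConsts) (cc : ℝ), 0 < cc → cc ≤ klEngC₃6 P R → cc ≤ cE →
      ∀ μ ∈ klWindowC, ∀ U : ℝ, 0 < U → U ≤ klEngU₀10 P R cc → U ≤ UE →
      ∀ β : ℝ, klBetaMin ≤ β → β ≤ Real.exp (cc / U ^ 2) →
      ∀ (L M : ℕ) [NeZero L] [NeZero M], klEngL₄ P R β U ≤ L → klEngM₃ β U L ≤ M →
      ∀ n : ℕ, 1 ≤ n → n ≤ nScales β + 1 → IsKLRegime U cc (-(n : ℤ)) →
      HistP klPredsV17F2 L M klEngGeo14 P Q R β U μ 0 n →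
      (∀ m, 1 ≤ m → m < n → FlowPieceOscAt L M (klReadOscC P R) β U μ m) →
      FrameOK R U (nScales β) μ (klFlowFrameU L M β U μ n) →
      (∀ j ≤ n, LevelsUExportMixedAt L M (klCU2 P R (klEngQ7 P R)) P β U μ j) →
      (∀ i, 1 ≤ i → i ≤ n → ∀ (q : Fin 2) (w : SpaceTimeIdx L M × SectorLeg (sectorCount (i - 1))),
        klWtPinnedSumOf L M β μ (klFlowFrameU L M β U μ n) (i - 1) 2 (klEffectiveAction L M β U μ (klFlowFrameU L M β U μ n) klE0 i) q w ≤
          (s₂u * |U| + s₂c * cc) * ((4 : ℝ) ^ (i - 1))⁻¹) ∧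
      (∀ i, 1 ≤ i → i ≤ n → ∀ (q : Fin 4) (τ' : Fin 4 → SectorLeg 1) (y' : SpaceTimeIdx L M),
        imagTimeWeight β M ^ 3 * ∑ x' ∈ univ.filter (fun x' : Fin 4 → SpaceTimeIdx L M => x' q = y'),
          klScaleWt L M β i ((univ.image x').image (fun x : SpaceTimeIdx L M => (((((2 * (x.1 : ℕ) : ℕ)) : ZMod (2 * (2 * M)))), x.2))) *
            ‖sectorisedKernel L M β (trivialMultiplier L M)
              (ExteriorAlgebra.map (LinearMap.mulLeft ℂ (fun K : HubbardFieldIdx L M => ((gnScaleCutoff 4 klE0 1 |matsubaraFreq β M K.1.1.1| : ℝ) : ℂ)))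
                (klEffectiveAction L M β U μ (klFlowFrameU L M β U μ n) klE0 i - hubbardInteraction L M β U)) 4 τ' x'‖ ≤ s₄ * epsCoupling P U i) ∧
      (∀ i, 1 ≤ i → i ≤ n → ∀ (q : Fin 6) (w : SpaceTimeIdx L M × SectorLeg (sectorCount (i - 1))),
        klWtPinnedSumOf L M β μ (klFlowFrameU L M β U μ n) (i - 1) 6 (klEffectiveAction L M β U μ (klFlowFrameU L M β U μ n) klE0 i) q w ≤
          S₆ * epsCoupling P U i ^ 2 * (2 : ℝ) ^ (4 * i))) :
    ∀ (P : SplitConsts) (R : RenConsts), P.WF → R.WF2 →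
      ∃ s₂u s₂c s₄ S₆ : ℝ, 0 ≤ s₂u ∧ 0 ≤ s₂c ∧ 0 ≤ s₄ ∧ 0 ≤ S₆ ∧ ∃ cE UE : ℝ, 0 < cE ∧ 0 < UE ∧
      ∀ (Q : EngConsts) (cc : ℝ), 0 < cc → cc ≤ klEngC₃6 P R → cc ≤ cE →
      ∀ μ ∈ klWindowC, ∀ U : ℝ, 0 < U → U ≤ klEngU₀10 P R cc → U ≤ UE →
      ∀ β : ℝ, klBetaMin ≤ β → β ≤ Real.exp (cc / U ^ 2) →
      ∀ (L M : ℕ) [NeZero L] [NeZero M], klEngL₄ P R β U ≤ L → klEngM₃ β U L ≤ M →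
      ∀ n : ℕ, 1 ≤ n → n ≤ nScales β + 1 → IsKLRegime U cc (-(n : ℤ)) →
      HistP klPredsV17F2 L M klEngGeo14 P Q R β U μ 0 n →
      (∀ m, 1 ≤ m → m < n → FlowPieceOscAt L M (klReadOscC P R) β U μ m) →
      FrameOK R U (nScales β) μ (klFlowFrameU L M β U μ n) →
      (∀ j ≤ n, LevelsUExportMixedAt L M (klCU2 P R (klEngQ7 P R)) P β U μ j) →
      (∀ i, 1 ≤ i → i ≤ n → ∀ (q : Fin 2) (w : SpaceTimeIdx L M × SectorLeg (sectorCount (i - 1))),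
        klWtPinnedSumOf L M β μ (klFlowFrameU L M β U μ n) (i - 1) 2 (klEffectiveAction L M β U μ (klFlowFrameU L M β U μ n) klE0 i) q w ≤
          (s₂u * |U| + s₂c * cc) * ((4 : ℝ) ^ (i - 1))⁻¹) ∧
      (∀ i, 1 ≤ i → i ≤ n → ∀ (q : Fin 4) (τ' : Fin 4 → SectorLeg 1) (y' : SpaceTimeIdx L M),
        imagTimeWeight β M ^ 3 * ∑ x' ∈ univ.filter (fun x' : Fin 4 → SpaceTimeIdx L M => x' q = y'),
          klScaleWt L M β i ((univ.image x').image (fun x : SpaceTimeIdx L M => (((((2 * (x.1 : ℕ) : ℕ)) : ZMod (2 * (2 * M)))), x.2))) *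
            ‖sectorisedKernel L M β (trivialMultiplier L M)
              (ExteriorAlgebra.map (LinearMap.mulLeft ℂ (fun K : HubbardFieldIdx L M => ((gnScaleCutoff 4 klE0 1 |matsubaraFreq β M K.1.1.1| : ℝ) : ℂ))) (klEffectiveAction L M β U μ (klFlowFrameU L M β U μ n) klE0 i)) 4 τ' x'‖ ≤ s₄ * epsCoupling P U i) ∧
      (∀ i, 1 ≤ i → i ≤ n → ∀ (q : Fin 6) (w : SpaceTimeIdx L M × SectorLeg (sectorCount (i - 1))),
        klWtPinnedSumOf L M β μ (klFlowFrameU L M β U μ n) (i - 1) 6 (klEffectiveAction L M β U μ (klFlowFrameU L M β U μ n) klE0 i) q w ≤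
          S₆ * epsCoupling P U i ^ 2 * (2 : ℝ) ^ (4 * i)) := by
  intro P R hP hR
  obtain ⟨s₂u, s₂c, s₄, S₆, h2u, h2c, h4, h6, cE, UE, hcE, hUE, H⟩ := hE₁rem P R hP hR
  have hK : 1 ≤ P.Klam := hP.1
  have hab : (0 : ℝ) ≤ (8 ^ 4 + 2 * klE0 * (8 * 20000 * 8 ^ 3)) / 24 := by
    have hE : (0 : ℝ) < klE0 := by norm_num [klE0]
    positivity
  refine ⟨s₂u, s₂c, s₄ + (8 ^ 4 + 2 * klE0 * (8 * 20000 * 8 ^ 3)) / 24, S₆, h2u, h2c, add_nonneg h4 hab, h6, cE, UE, hcE, hUE, ?_⟩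
  intro Q cc hcc hcc6 hccE μ hμ U hU hU10 hUUE β hβ hβc L M _ _ hL hM n hn1 hn hreg hhist hosc hfr hlev
  obtain ⟨hE2, hE4, hE6⟩ := H Q cc hcc hcc6 hccE μ hμ U hU hU10 hUUE β hβ hβc L M hL hM n hn1 hn hreg hhist hosc hfr hlev
  refine ⟨hE2, ?_, hE6⟩
  intro i hi1 hin q τ' y'
  have h128 : (128 : ℝ) ≤ β := le_trans (by norm_num [klBetaMin]) hβ
  have hβ0 : (0 : ℝ) ≤ β := le_trans (by norm_num) h128
  have hβM : β ≤ (M : ℝ) := beta_le_of_klEngM₃_le hM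
  have hbare := klbv_scaleWtCurrency_uvCut_hubbardInteraction_le_epsCoupling (L := L) (M := M) hK h128 hβM i U τ' q y'
  have hremv := hE4 i hi1 hin q τ' y'
  have hsplit := klbv_wtPinnedSum_norm_sectorisedKernel_le_add (m := 4) β (trivialMultiplier L M)
    (ExteriorAlgebra.map (LinearMap.mulLeft ℂ (fun K : HubbardFieldIdx L M => ((gnScaleCutoff 4 klE0 1 |matsubaraFreq β M K.1.1.1| : ℝ) : ℂ)))
      (klEffectiveAction L M β U μ (klFlowFrameU L M β U μ n) klE0 i))
    (ExteriorAlgebra.map (LinearMap.mulLeft ℂ (fun K : HubbardFieldIdx L M => ((gnScaleCutoff 4 klE0 1 |matsubaraFreq β M K.1.1.1| : ℝ) : ℂ)))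
      (hubbardInteraction L M β U))
    τ' (univ.filter (fun x' : Fin 4 → SpaceTimeIdx L M => x' q = y'))
    (fun x' => klScaleWt L M β i ((univ.image x').image (fun x : SpaceTimeIdx L M => (((((2 * (x.1 : ℕ) : ℕ)) : ZMod (2 * (2 * M)))), x.2))))
    (fun x' => le_trans zero_le_one (one_le_klScaleWt L M β i _)) (pow_nonneg (imagTimeWeight_nonneg hβ0 M) 3)
  rw [← map_sub] at hsplit
  calc _ ≤ _ := hsplit
    _ ≤ (8 ^ 4 + 2 * klE0 * (8 * 20000 * 8 ^ 3)) / 24 * epsCoupling P U i + s₄ * epsCoupling P U i := add_le_add hbare hremv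
    _ = _ := by ring

/-! ## §3 The slot-(b) reader with BOTH plain quartic binders replaced by their remainders -/

/-- **ROW (b) FROM E1-CLASS DATA, BINDERS #5 AND #6 REPLACED BY THEIR REMAINDERS** — the ★ v22 slot-(b) reader `stub_engine_step_norms_of_E1data₃LBcut56`
with `hE₁cut` supplied by `hE₁cut_of_remainder` and `hplainE1cut` by `hplainE1cut_of_remainder`: hypotheses **`hE₁rem`** (E1's (E2)∧(E4)∧(E6) family,
the UV-cut (E4) conjunct on `𝒱ᵢ[Kₙ] − V`), numeric `a′ ≥ 0`, `bfun ≥ 0`, `u₀ > 0`, **`hrem`** (binder #6 on `𝒱ₙ − V`), `hincr′` ⊢ row (b) VERBATIM.  Every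
binder is a HYPOTHESIS; nothing is asserted. [cite: BenfattoGiulianiMastropietro2006, §2.5-§2.8 (2.52)-(2.84), Lemma 2.5 (2.98), §3 (3.2)-(3.8)] -/
theorem stub_engine_step_norms_of_E1data₃LBcut56_remainder₂
    (hE₁rem : ∀ (P : SplitConsts) (R : RenConsts), P.WF → R.WF2 →
      ∃ s₂u s₂c s₄ S₆ : ℝ, 0 ≤ s₂u ∧ 0 ≤ s₂c ∧ 0 ≤ s₄ ∧ 0 ≤ S₆ ∧ ∃ cE UE : ℝ, 0 < cE ∧ 0 < UE ∧
      ∀ (Q : EngConsts) (cc : ℝ), 0 < cc → cc ≤ klEngC₃6 P R → cc ≤ cE →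
      ∀ μ ∈ klWindowC, ∀ U : ℝ, 0 < U → U ≤ klEngU₀10 P R cc → U ≤ UE →
      ∀ β : ℝ, klBetaMin ≤ β → β ≤ Real.exp (cc / U ^ 2) →
      ∀ (L M : ℕ) [NeZero L] [NeZero M], klEngL₄ P R β U ≤ L → klEngM₃ β U L ≤ M →
      ∀ n : ℕ, 1 ≤ n → n ≤ nScales β + 1 → IsKLRegime U cc (-(n : ℤ)) →
      HistP klPredsV17F2 L M klEngGeo14 P Q R β U μ 0 n →
      (∀ m, 1 ≤ m → m < n → FlowPieceOscAt L M (klReadOscC P R) β U μ m) →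
      FrameOK R U (nScales β) μ (klFlowFrameU L M β U μ n) →
      (∀ j ≤ n, LevelsUExportMixedAt L M (klCU2 P R (klEngQ7 P R)) P β U μ j) →
      (∀ i, 1 ≤ i → i ≤ n → ∀ (q : Fin 2) (w : SpaceTimeIdx L M × SectorLeg (sectorCount (i - 1))),
        klWtPinnedSumOf L M β μ (klFlowFrameU L M β U μ n) (i - 1) 2 (klEffectiveAction L M β U μ (klFlowFrameU L M β U μ n) klE0 i) q w ≤
          (s₂u * |U| + s₂c * cc) * ((4 : ℝ) ^ (i - 1))⁻¹) ∧
      (∀ i, 1 ≤ i → i ≤ n → ∀ (q : Fin 4) (τ' : Fin 4 → SectorLeg 1) (y' : SpaceTimeIdx L M),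
        imagTimeWeight β M ^ 3 * ∑ x' ∈ univ.filter (fun x' : Fin 4 → SpaceTimeIdx L M => x' q = y'),
          klScaleWt L M β i ((univ.image x').image (fun x : SpaceTimeIdx L M => (((((2 * (x.1 : ℕ) : ℕ)) : ZMod (2 * (2 * M)))), x.2))) *
            ‖sectorisedKernel L M β (trivialMultiplier L M)
              (ExteriorAlgebra.map (LinearMap.mulLeft ℂ (fun K : HubbardFieldIdx L M => ((gnScaleCutoff 4 klE0 1 |matsubaraFreq β M K.1.1.1| : ℝ) : ℂ)))
                (klEffectiveAction L M β U μ (klFlowFrameU L M β U μ n) klE0 i - hubbardInteraction L M β U)) 4 τ' x'‖ ≤ s₄ * epsCoupling P U i) ∧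
      (∀ i, 1 ≤ i → i ≤ n → ∀ (q : Fin 6) (w : SpaceTimeIdx L M × SectorLeg (sectorCount (i - 1))),
        klWtPinnedSumOf L M β μ (klFlowFrameU L M β U μ n) (i - 1) 6 (klEffectiveAction L M β U μ (klFlowFrameU L M β U μ n) klE0 i) q w ≤
          S₆ * epsCoupling P U i ^ 2 * (2 : ℝ) ^ (4 * i)))
    {a' : ℝ} (ha' : 0 ≤ a') {bfun u₀ : GeoConsts → SplitConsts → RenConsts → EngConsts → ℝ → ℝ}
    (hb : ∀ G P R Q cc, 0 ≤ bfun G P R Q cc) (hu₀ : ∀ G P R Q cc, 0 < u₀ G P R Q cc)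
    (hrem : ∀ (G : GeoConsts), G.WF → ∀ (P : SplitConsts) (R : RenConsts) (Q : EngConsts) (cc : ℝ), P.WF → R.WF2 → Q.WF → 0 < cc →
      cc ≤ klEngC₃6 P R → ∀ μ ∈ klWindowC, ∀ U : ℝ, 0 < U → U ≤ u₀ G P R Q cc →
      ∀ β : ℝ, klBetaMin ≤ β → β ≤ Real.exp (cc / U ^ 2) →
      ∀ (L M : ℕ) [NeZero L] [NeZero M], klEngL₃ β U ≤ L → klEngM₃ β U L ≤ M →
      ∀ n : ℕ, 1 ≤ n → n ≤ nScales β + 1 → IsKLRegime U cc (-(n : ℤ)) →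
        HistP klPredsV17F2 L M G P Q R β U μ 0 n → FrameOK R U (nScales β) μ (klFlowFrameU L M β U μ n) →
        ∀ (τ' : Fin 4 → SectorLeg 1) (y : SpaceTimeIdx L M),
          imagTimeWeight β M ^ 3 * ∑ x' ∈ univ.filter (fun x' : Fin 4 → SpaceTimeIdx L M => x' 0 = y),
            klScaleWt L M β n ((univ.image x').image (fun x : SpaceTimeIdx L M => (((((2 * (x.1 : ℕ) : ℕ)) : ZMod (2 * (2 * M)))), x.2))) *
              ‖sectorisedKernel L M β (trivialMultiplier L M)
                (ExteriorAlgebra.map (LinearMap.mulLeft ℂ (fun K : HubbardFieldIdx L M => ((gnScaleCutoff 4 klE0 1 |matsubaraFreq β M K.1.1.1| : ℝ) : ℂ)))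
                  (klEffectiveAction L M β U μ (klFlowFrameU L M β U μ n) klE0 n - hubbardInteraction L M β U)) 4 τ' x'‖ ≤
          klE0 * (a' * |U| + bfun G P R Q cc * (P.Klam * U) ^ 2))
    (hincr : ∀ (P : SplitConsts) (R : RenConsts), P.WF → R.WF2 →
      ∃ Bw : ℝ, 0 ≤ Bw ∧ ∃ uI : EngConsts → ℝ → ℝ, (∀ Q cc, 0 < uI Q cc) ∧ ∃ cI : ℝ, 0 < cI ∧
      ∀ Q : EngConsts, (klEngQ7 P R).IsRaiseOf Q →
      ∀ cc : ℝ, 0 < cc → cc ≤ klEngC₃6 P R → cc ≤ cI →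
      ∀ μ ∈ klWindowC, ∀ U : ℝ, 0 < U → U ≤ klEngU₀10 P R cc → U ≤ uI Q cc →
      ∀ β : ℝ, klBetaMin ≤ β → β ≤ Real.exp (cc / U ^ 2) →
      ∀ (L M : ℕ) [NeZero L] [NeZero M], klEngL₄ P R β U ≤ L → klEngM₃ β U L ≤ M →
      ∀ n : ℕ, 1 ≤ n → n ≤ nScales β + 1 →
        HistP klPredsV17F2 L M klEngGeo14 P Q R β U μ 0 n → FrameOK R U (nScales β) μ (klFlowFrameU L M β U μ n) →
        ∃ b : ℕ → ℝ, (∑ j ∈ range n, (klScale klE0 (j + 1))⁻¹ * b j ≤ Bw) ∧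
          ∀ j < n, ∀ w : GridLeg (GridPoint L (2 * (2 * M))),
            ∑ Y ∈ univ.filter (fun Y : Fin 2 → GridLeg (GridPoint L (2 * (2 * M))) => Y 0 = w),
              (klScaleWt L M β (j + 1) ((univ.image Y).image gridLegPos) - 1) *
                ‖kernel ℂ
                  (effAction ℂ ((hubbardGridSub L M β (2 * (2 * M))).transpose *
                      hubbardCovAboveCT L M β μ 0 (klFlowFrameU L M β U μ n) (klScale klE0 (j + 1)) * hubbardGridSub L M β (2 * (2 * M)))
                    (hubbardGridInteraction L (2 * (2 * M)) β U + hubbardGridCounterQuadratic L (2 * (2 * M)) β (klFlowFrameU L M β U μ n)) -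
                  effAction ℂ ((hubbardGridSub L M β (2 * (2 * M))).transpose *
                      hubbardCovAboveCT L M β μ 0 (klFlowFrameU L M β U μ n) (klScale klE0 j) * hubbardGridSub L M β (2 * (2 * M)))
                    (hubbardGridInteraction L (2 * (2 * M)) β U + hubbardGridCounterQuadratic L (2 * (2 * M)) β (klFlowFrameU L M β U μ n))) 2 Y‖ ≤
              b j * U ^ 2 * (β / (2 * ((2 * (2 * M) : ℕ) : ℝ)))) :
    ∀ (P : SplitConsts) (R : RenConsts) (c : ℝ), P.WF → R.WF2 → 0 < c → c ≤ klEngC₃7GU klEngGeo14 P R →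
      ∀ μ ∈ klWindowC, ∀ U : ℝ, 0 < U → U ≤ klEngU₀12GQ klEngGeo14 (klEngQ9dG klEngGeo14 P R) P R c → ∀ β : ℝ, klBetaMin ≤ β → β ≤ Real.exp (c / U ^ 2) →
        ∀ (L M : ℕ) [NeZero L] [NeZero M], klEngL₄ P R β U ≤ L → klEngM₃ β U L ≤ M →
          ∀ n : ℕ, 1 ≤ n → n ≤ nScales β + 1 → IsKLRegime U c (-(n : ℤ)) →
            HistP klPredsV17F2 L M klEngGeo14 P (klEngQ9dG klEngGeo14 P R) R β U μ 0 n →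
              (∀ m, 1 ≤ m → m < n → FlowPieceOscAt L M (klReadOscC P R) β U μ m) →
              FrameOK R U (nScales β) μ (klFlowFrameU L M β U μ n) →
                (∀ j ≤ n, LevelsUExportMixedAt L M (klCU2 P R (klEngQ7 P R)) P β U μ j) →
                  KernelNormsV4 L M P (klEngQ9dG klEngGeo14 P R) β U μ (klFlowFrameU L M β U μ n) n ∧
                    (∀ j ≤ n, (KernelNormsLevels L M P (klEngQ9dG klEngGeo14 P R) β U μ (klFlowFrameU L M β U μ n) j ∧
                      KernelNormsWt4 L M (klWtBudget P (klEngQ9dG klEngGeo14 P R) U j) β U μ (klFlowFrameU L M β U μ n) j)) ∧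
                    EngineFirstMoments L M klEngGeo14 P (klEngQ9dG klEngGeo14 P R) β U μ (klFlowFrameU L M β U μ n) n ∧
                    IsoFirstMomentsAt L M klIsoMomC (klIsoMomD P R) P β U μ n ∧
                    TwoLegGridFlowMomentsAtC L M (klZtG klEngGeo14 P R) (klZs1G klEngGeo14 P R) (klZs2G klEngGeo14 P R) c β U μ n :=
  stub_engine_step_norms_of_E1data₃LBcut56_remainder (hE₁cut_of_remainder hE₁rem) ha' hb hu₀ hrem hincr

end Summit.HubbardSuperconductivity.HubbardSuperconductivity.Theorems.EngineV8.A24a1G14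

end
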